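import Summits.Ventures.AbcSig.Rows.XTemplateHalves
import Summits.Ventures.AbcSig.Rows.XTemplateC2a
import Summits.Ventures.AbcSig.Rows.XTemplateAB
import Summits.Ventures.AbcSig.Rows.C2aL197A0xyeven
import Summits.Ventures.AbcSig.Levels.N394M6X

/-!
# Venture AbcSig — PARITY-HALF ROW `C2aL197A0xyevenAB`: `197^m·xⁿ + yⁿ = z²`, `xy` even (second distribution, by symmetry) at the single level 394 = 2·197 (GENERATED by p-lean g4 `gen4/evenhalf.py`)

HONEST FRAMING. A row of a COMPUTATION cell (`pub-abcsig`); a CONDITIONAL theorem, no claim on ABC or any summit.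
Hypotheses: `BS04Package` (CITED); `DataComplete 394` (COMPUTED: certified level file, ordinary ℤ[θ] certificates); `EisPackage` (CITED) + `Refines` (COMPUTED) for the module-M6 residue discharged IN THE KERNEL (`Levels/N394M6X.lean`);
the listed per-orbit exclusions `hX_…` (CITED: the row of record's closures). Only the parity half living at level 2·197 is claimed
(the complementary half needs level 32·197). Exponent range: prime `n ≥ 11`, `n ≠ 197`; `1 ≤ m < n`.
Level 394 = 2·197 (ordinary tree certificates); the module-M6 residue (394.4 @ 11) is DISCHARGED IN THE KERNEL (Levels/N394M6X.lean); other residues per the row of record's R3 (CITED hX_ if any).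
Row of record: `census/rows/C2a/C2a-l197-a0-xyeven.md` (sha16 `e2383fc37d436d17`; SIGNED 2026-08-22T16:05:08Z by referee (ref-g11) — C).
-/

namespace Summit.Ventures.AbcSig

/-- Parity-half row `C2aL197A0xyevenAB`: the first distribution with `x, y` swapped (`IsPrimitiveSolution.swap`). -/
theorem xrow_C2aL197A0xyevenAB (M : NewformModel) (hP : M.BS04Package)
    (hE : M.EisPackage)
    (hR_orbit_394_4 : M.Refines 394 orbit_394_4 m6X_394_4)
    (hD394 : M.DataComplete 394 level394Orbits)
    (n : ℕ) (hn : n.Prime) (hmin : 11 ≤ n) (hnℓ : n ≠ 197) (m : ℕ) (hm : 1 ≤ m) (hmn : m < n)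
    (x y z : ℤ) (hxy : 2 ∣ x * y) : ¬ IsPrimitiveSolution (197 ^ m) (2 ^ 0) 1 n x y z := by
  intro h
  have h' : IsPrimitiveSolution 1 (2 ^ 0 * 197 ^ m) 1 n y x z := by simpa only [pow_zero, one_mul] using h.swap
  exact xrow_C2aL197A0xyeven M hP hE hR_orbit_394_4 hD394 n hn hmin hnℓ m hm hmn  y x z (by rwa [mul_comm]) h'

end Summit.Ventures.AbcSig
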